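import Summits.Ventures.YMGap.YM3IR.Statement
import Summits.Ventures.YMGap.YM3IR.StrongCoupling
import HarnessLib

/-!
# YM₃ infrared statement — the cofinal TARGET `LatticeMassGap3Cofinal I …` HOLDS on every compact
# strong-coupling interval `I = [a, b] ⊂ (0, 2N/45]`, every `SU(N)`, `N ≥ 2` (non-vacuity of the target's shape)

HONEST FRAMING: venture file of the cell `pub-ymgap` (QuantumFields programme; seat ds-1, for track Y4).  A SANITY
ROW for theory-2's conjecture-labelled target `YM3IR.LatticeMassGap3Cofinal I r ρ m₀ C_b` (part 2,
`YM3IR/Statement.lean`): its shape — block length `b ≤ C_b β`, one constant on all tori of side a multiple `≥ 3b` of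
`b`, rate `m₀/β` — is SATISFIED on every compact coupling interval inside the strong-coupling window, with `b = 1`,
`C_b = 1/a`, `m₀ = m₃·a`, by the kernel theorem `StrongCoupling.uniformClustering_wilsonFamily3_SU`.  This says
NOTHING at weak coupling: `MassGap3Cofinal I r ρ` additionally demands `¬ BddAbove I`, which no bounded interval
meets — the genuine conjecture is untouched.  Lattice statements only; no continuum; not a Clay-problem statement;
`0` compute.  Coupling convention as in `YM3IR/StrongCoupling.lean` (tree `β = β_W/N`).

OUTPUT: `latticeMassGap3Cofinal_strongCoupling (hN : 2 ≤ N) (ha : 0 < a) (hb : b ≤ 2N/45) :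
LatticeMassGap3Cofinal (Set.Icc a b) suFrobDist (fundamentalRep (Fin N)) (m₃·a) (1/a)` (`m₃ = κ_3(528/545) > 0`),
the `SU(2)` twin on `[a, b] ⊂ (0, 5/18]`, and the packaged `∃ m₀ > 0, ∃ C_b` form.

References: Osterwalder–Seiler, Ann. Phys. 110 (1978) §3; cell file YM3-IR.md (ym3ir-theory-1/2).
-/

noncomputable section

open MeasureTheory
open Literature.MathematicalPhysics.QuantumLattice (fundamentalRep)
open Literature.MathematicalPhysics.QuantumFieldTheory
open Summit.Ventures.YMGap.StarResolventDim (gaugeR)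
open Summit.Ventures.YMGap.YM3IR.StrongCoupling

namespace Summit.Ventures.YMGap.YM3IR.StrongCouplingCofinal

variable {N : ℕ}

/-- **The cofinal target on a compact strong-coupling interval, every `SU(N)`, `N ≥ 2`**: for `0 < a` and
`b ≤ 2N/45`, `LatticeMassGap3Cofinal [a, b] suFrobDist (fundamentalRep (Fin N)) (m₃·a) (1/a)` with
`m₃ = κ_3(R_G^{(3)}(4/29))` — block length `b(β) = 1 ≤ β/a`, all tori of side `M ≥ 3`, rate `m₃ a/β ≤ m₃`
(`StrongCoupling.uniformClustering_wilsonFamily3_SU` + `ClustersWith.mono`).  Non-vacuity of the target's shape;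
nothing at weak coupling. [folklore] -/
theorem latticeMassGap3Cofinal_strongCoupling (hN : 2 ≤ N) {a b : ℝ} (ha : 0 < a) (hb : b ≤ 2 * N / 45) :
    YM3IR.LatticeMassGap3Cofinal (Set.Icc a b) suFrobDist (fundamentalRep (Fin N))
      ((1 - gaugeR 3 (4 / 29)) ^ 2 / (2 * (2 * gaugeR 3 (4 / 29) * ((2 * 3 : ℕ) : ℝ) + 1)) * a) (1 / a) := by
  intro β hβ
  obtain ⟨haβ, hβb⟩ := hβ
  have hβ0 : 0 < β := lt_of_lt_of_le ha haβ
  have hβabs : |β| ≤ 2 * N / 45 := by rw [abs_of_pos hβ0]; linarith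
  obtain ⟨A, hA⟩ := uniformClustering_wilsonFamily3_SU hN hβabs
  refine ⟨1, one_pos, ?_, max A 0, fun M _ _ hM => ?_⟩
  · rw [Nat.cast_one, one_div_mul_eq_div, le_div_iff₀ ha, one_mul]; exact haβ
  · have h : YM3IR.ClustersWith suFrobDist (wilsonMeasure (d := 3) (L := M) (fundamentalRep (Fin N)) β) A
        ((1 - gaugeR 3 (4 / 29)) ^ 2 / (2 * (2 * gaugeR 3 (4 / 29) * ((2 * 3 : ℕ) : ℝ) + 1))) :=
      hA M (by simpa using hM)
    refine h.mono ?_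
    have hm0 := uniformClustering_wilsonFamily3_SU_rate_pos
    rw [mul_div_assoc]
    refine mul_le_of_le_one_right hm0.le ?_
    rw [div_le_one hβ0]; exact haβ

/-- **`SU(2)` twin**: for `0 < a`, `b ≤ 5/18` (Wilson `β_W ≤ 5/9`),
`LatticeMassGap3Cofinal [a, b] suFrobDist (fundamentalRep (Fin 2)) (m·a) (1/a)`, `m = κ_3(R_G^{(3)}(5/36))`. [folklore] -/
theorem latticeMassGap3Cofinal_strongCoupling_SU2 {a b : ℝ} (ha : 0 < a) (hb : b ≤ 5 / 18) :
    YM3IR.LatticeMassGap3Cofinal (Set.Icc a b) suFrobDist (fundamentalRep (Fin 2))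
      ((1 - gaugeR 3 (5 / 36)) ^ 2 / (2 * (2 * gaugeR 3 (5 / 36) * ((2 * 3 : ℕ) : ℝ) + 1)) * a) (1 / a) := by
  intro β hβ
  obtain ⟨haβ, hβb⟩ := hβ
  have hβ0 : 0 < β := lt_of_lt_of_le ha haβ
  have hβabs : |β| ≤ 5 / 18 := by rw [abs_of_pos hβ0]; linarith
  obtain ⟨A, hA⟩ := uniformClustering_wilsonFamily3_SU2 hβabs
  refine ⟨1, one_pos, ?_, max A 0, fun M _ _ hM => ?_⟩
  · rw [Nat.cast_one, one_div_mul_eq_div, le_div_iff₀ ha, one_mul]; exact haβ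
  · have h : YM3IR.ClustersWith suFrobDist (wilsonMeasure (d := 3) (L := M) (fundamentalRep (Fin 2)) β) A
        ((1 - gaugeR 3 (5 / 36)) ^ 2 / (2 * (2 * gaugeR 3 (5 / 36) * ((2 * 3 : ℕ) : ℝ) + 1))) :=
      hA M (by simpa using hM)
    refine h.mono ?_
    have hm0 := uniformClustering_wilsonFamily3_SU2_rate_pos
    rw [mul_div_assoc]
    refine mul_le_of_le_one_right hm0.le ?_
    rw [div_le_one hβ0]; exact haβ

/-- **Packaged**: for every `SU(N)`, `N ≥ 2`, and every compact interval `[a, b] ⊂ (0, 2N/45]`, SOME `m₀ > 0` and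
`C_b` satisfy `LatticeMassGap3Cofinal [a, b] suFrobDist (fundamentalRep (Fin N)) m₀ C_b` — the target predicate is
inhabited at strong coupling; `MassGap3Cofinal` (which needs `¬ BddAbove I`) is NOT claimed. [folklore] -/
theorem exists_latticeMassGap3Cofinal_strongCoupling (hN : 2 ≤ N) {a b : ℝ} (ha : 0 < a)
    (hb : b ≤ 2 * N / 45) :
    ∃ m₀ : ℝ, 0 < m₀ ∧ ∃ C_b : ℝ,
      YM3IR.LatticeMassGap3Cofinal (Set.Icc a b) suFrobDist (fundamentalRep (Fin N)) m₀ C_b :=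
  ⟨_, mul_pos uniformClustering_wilsonFamily3_SU_rate_pos ha, _, latticeMassGap3Cofinal_strongCoupling hN ha hb⟩

/-- The honest complement: a bounded coupling set never meets the first conjunct of `MassGap3Cofinal`
(`¬ BddAbove I`), so the rows above do not produce `MassGap3Cofinal [a, b] …` — bookkeeping. [folklore] -/
theorem bddAbove_Icc_coupling (a b : ℝ) : BddAbove (Set.Icc a b) := bddAbove_Icc

end Summit.Ventures.YMGap.YM3IR.StrongCouplingCofinal

end
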